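import Literature.Barriers.ValiantsHypothesis.RankLiftingFrames
import Literature.Computability.AlgebraicComplexity.LinearPowersSpan
import Literature.Barriers.ValiantsHypothesis.NumericToSymbolicProp34
import HarnessLib

/-!
# Proof of the lifting barrier for forms (GMOW 2019, Thm. 1.16) from the numeric-to-symbolic
transfer (Cor. 1.23)

Topic `Literature/Barriers/ValiantsHypothesis`; proves `GMOW2019_thm116` of
`RankLiftingBarrier.lean` (for every `d` and `k ≥ 2` a constant `B_{d,k}` with
`trk φ(f) ≤ B_{d,k} · n^{⌊(k-1)d/k⌋} · r` for every `T_k`-rank method `φ : P(n,d) → Ten(m,k)` with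
`trk φ(ℓ^d) ≤ r` on powers of linear forms and every form `f` of degree `d`) from the named fact
`GMOW2019_cor123` (Cor. 1.23, `NumericToSymbolicTransfer.lean`, itself reduced there to Thm. 1.21
and Props. 3.3/3.4), following §5.3 of the paper — the companion of
`RankLiftingBarrierProofs.lean` (Thm. 1.14, tensors, §5.2); the polynomial map
`L = φ ∘ ψ` (`liftPoly`), the coefficient spans `𝒞_{t,j,ν}` and the frame subspace `W`
(`liftRange`) are in `RankLiftingFrames.lean`.

* Cor. 1.23 applied to `L` (every `L(β) = φ(ℓ_β^d)` has `trk ≤ r`) gives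
  `L(z + c) = ∑_{t<r} ⊗_j p_{t,j}(z)` with vectors of power series `p_{t,j}`; comparing
  coefficients (`MvPowerSeries.coeff_prod`) writes every `φ(ℓ_α^d) = L((α - c) + c)` as a
  combination of rank-one tensors `⊗_j v_{t,j,e_j}` of coefficient vectors with `∑_j |e_j| ≤ d`,
  all of which lie in `W` (`apply_linearForm_pow_mem_liftRange`; the paper's finite monomial
  decomposition and Lemma 5.11).
* Powers of linear forms span the forms (`mem_span_linearPowers_of_isHomogeneous`), so `φ(f) ∈ W`
  and `trk φ(f) ≤ #frames ≤ r · (d+1)^k · n^{⌊(k-1)d/k⌋}`: `GMOW2019_thm116_of_cor123` with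
  `B_{d,k} = (d+1)^k` (the paper leaves `B_{d,k}` inexplicit; the cases `n = 0` are degenerate).

With Cor. 1.23 discharged in the tree (`GMOW2019_cor123_holds`, `NumericToSymbolicProp34.lean`:
Prop. 3.3 by the Nullstellensatz, Prop. 3.4 by the elementary Hensel route of
`Literature/RingTheory/PolynomialMaps/`, Thm. 1.21 and Cor. 1.23 by the proved implications of
`NumericToSymbolicTransfer.lean`), the discharge `GMOW2019_thm116_holds` is unconditional.

## References

* [GargMakamOliveiraWigderson2019] A. Garg, V. Makam, R. Oliveira, A. Wigderson, *More barriers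
  for rank methods, via a "numeric to symbolic" transfer*, FOCS 2019 (arXiv:1904.04299), §5.3
  (Lemma 5.11, Cor. 5.12, 5.14, proof of Thm. 1.16), §1.5 (Cor. 1.23).
-/

noncomputable section

open scoped BigOperators

namespace Literature.Barriers.ValiantsHypothesis

open Literature.Computability.AlgebraicComplexity MvPolynomial

variable {F : Type*} [Field F] {n m k : ℕ}

/-! ### The monomial decomposition puts `φ(S)` inside `W` -/

/-- **GMOW 2019, Lemma 5.11:** given the power series decomposition of `L(z + c)` (Cor. 1.23),
every `φ(ℓ_α^d)` lies in `W`. [cite: GargMakamOliveiraWigderson2019, Lemma 5.11] -/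
theorem apply_linearForm_pow_mem_liftRange [NeZero k] {d r : ℕ}
    (φ : MvPolynomial (Fin n) F →ₗ[F] ((Fin k → Fin m) → F)) (c : Fin n → F)
    (p : Fin r → Fin k → Fin m → MvPowerSeries (Fin n) F)
    (hp : ∀ i : Fin k → Fin m,
      ((aeval (fun s : Fin n => X s + C (c s)) (liftPoly d φ i) : MvPolynomial (Fin n) F) :
        MvPowerSeries (Fin n) F) = ∑ t, ∏ j, p t j (i j))
    (α : Fin n → F) : φ (linearForm α ^ d) ∈ liftRange p d := by
  classical
  set L' : (Fin k → Fin m) → MvPolynomial (Fin n) F := fun i =>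
    aeval (fun s : Fin n => X s + C (c s)) (liftPoly d φ i) with hL'
  set Ebig : Finset (Fin n →₀ ℕ) := Finset.univ.biUnion fun i => (L' i).support with hEbig
  have hdegE : ∀ e ∈ Ebig, e.degree ≤ d := by
    intro e he
    obtain ⟨i, _, hi⟩ := Finset.mem_biUnion.1 he
    exact (le_totalDegree hi).trans (totalDegree_aeval_liftPoly_le d φ i c)
  set w : Fin n → F := α - c with hw
  -- coefficients of `L'` from the power series identity
  have hcoeff : ∀ (i : Fin k → Fin m) (e : Fin n →₀ ℕ), coeff e (L' i) =
      ∑ t, ∑ E ∈ (Finset.univ : Finset (Fin k)).finsuppAntidiag e,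
        ∏ j, MvPowerSeries.coeff (E j) (p t j (i j)) := by
    intro i e
    rw [← coeff_coe, hL']
    dsimp only
    rw [hp i, map_sum]
    refine Finset.sum_congr rfl fun t _ => ?_
    rw [MvPowerSeries.coeff_prod]
  -- the monomial decomposition of `φ(ℓ_α^d) = L'(α - c)`
  have hT : φ (linearForm α ^ d) = ∑ e ∈ Ebig, (∏ s, w s ^ e s) •
      ∑ t : Fin r, ∑ E ∈ (Finset.univ : Finset (Fin k)).finsuppAntidiag e,
        rankOneTensor (fun j => coeffVec p t j (E j)) := by
    funext i
    have h1 : φ (linearForm α ^ d) i = eval w (L' i) := by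
      rw [← eval_liftPoly, hL']
      dsimp only
      rw [eval_aeval_X_add_C, hw, sub_add_cancel]
    have h2 : eval w (L' i) = ∑ e ∈ Ebig, coeff e (L' i) * ∏ s, w s ^ e s := by
      rw [eval_eq']
      refine Finset.sum_subset (Finset.subset_biUnion_of_mem (fun i => (L' i).support)
        (Finset.mem_univ i)) fun e _ he => ?_
      rw [notMem_support_iff.1 he, zero_mul]
    rw [h1, h2, Finset.sum_apply]
    refine Finset.sum_congr rfl fun e _ => ?_
    rw [Pi.smul_apply, smul_eq_mul, mul_comm, hcoeff i e, Finset.sum_apply]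
    congr 1
    refine Finset.sum_congr rfl fun t _ => ?_
    rw [Finset.sum_apply]
    refine Finset.sum_congr rfl fun E _ => ?_
    rw [rankOneTensor_apply]
    rfl
  rw [hT]
  refine Submodule.sum_mem _ fun e he => Submodule.smul_mem _ _
    (Submodule.sum_mem _ fun t _ => Submodule.sum_mem _ fun E hE => ?_)
  refine rankOneTensor_coeffVec_mem_liftRange p d t E ?_
  have hsum : ∑ j, E j = e := by
    have := (Finset.mem_finsuppAntidiag.1 hE).1
    exact this
  calc ∑ j, (E j).degree = (∑ j, E j).degree := (map_sum Finsupp.degree _ _).symm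
    _ = e.degree := by rw [hsum]
    _ ≤ d := hdegE e he

/-! ### Assembly -/

/-- Degenerate case `n = 0`, `d ≥ 1`: there are no nonzero forms. [folklore] -/
theorem eq_zero_of_isHomogeneous_fin_zero {d : ℕ} (hd : d ≠ 0) {f : MvPolynomial (Fin 0) F}
    (hf : f.IsHomogeneous d) : f = 0 := by
  by_contra hne
  have hC : f = C (coeff 0 f) := by
    ext e
    have he : e = 0 := Subsingleton.elim e 0
    subst he
    rw [coeff_C, if_pos rfl]
  have h0 : f.IsHomogeneous 0 := by rw [hC]; exact isHomogeneous_C _ _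
  exact hd (hf.inj_right h0 hne)

/-- **GMOW 2019, Thm. 1.16 from Cor. 1.23.** For every `d` and `k ≥ 2`, with `B_{d,k} = (d+1)^k`:
over an algebraically closed field of characteristic zero, every `T_k`-rank method
`φ : P(n,d) → Ten(m,k)` with `trk φ(ℓ^d) ≤ r` on powers of linear forms has
`trk φ(f) ≤ B_{d,k} · n^{⌊(k-1)d/k⌋} · r` on every form `f` of degree `d`.
[cite: GargMakamOliveiraWigderson2019, Thm. 1.16] -/
theorem GMOW2019_thm116_of_cor123 (h : GMOW2019_cor123) : GMOW2019_thm116 := by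
  intro d k hk
  refine ⟨(d + 1) ^ k, ?_⟩
  intro F _ _ _ n m φ r hr f hf
  classical
  haveI : NeZero k := ⟨by omega⟩
  rcases Nat.eq_zero_or_pos n with hn0 | hn
  · -- `n = 0`
    subst hn0
    rcases Nat.eq_zero_or_pos d with hd0 | hd
    · -- `d = 0`: `f` is a constant, a multiple of `ℓ^0 = 1`
      subst hd0
      have hfC : f = coeff 0 f • (linearForm (0 : Fin 0 → F) ^ 0) := by
        rw [pow_zero, smul_eq_C_mul, mul_one]
        ext e
        have he : e = 0 := Subsingleton.elim e 0
        subst he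
        rw [coeff_C, if_pos rfl]
      rw [hfC, map_smul]
      calc tensorRankD (coeff 0 f • φ (linearForm 0 ^ 0)) ≤ tensorRankD (φ (linearForm 0 ^ 0)) :=
            tensorRankD_smul_le _ _
        _ ≤ r := hr 0
        _ ≤ (0 + 1) ^ k * 0 ^ ((k - 1) * 0 / k) * r := by
            rw [Nat.mul_zero, Nat.zero_div, pow_zero, mul_one]
            exact Nat.le_mul_of_pos_left r (pow_pos Nat.one_pos k)
    · -- `d ≥ 1`: `f = 0`
      have hf0 : f = 0 := eq_zero_of_isHomogeneous_fin_zero (by omega) hf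
      rw [hf0, map_zero, tensorRankD_zero]
      exact Nat.zero_le _
  · -- `n ≥ 1`: the argument of §5.3
    have hL : ∀ β : Fin n → F,
        tensorRankD (fun i : Fin k → Fin m => eval β (liftPoly d φ i)) ≤ r := by
      intro β
      have : (fun i : Fin k → Fin m => eval β (liftPoly d φ i)) = φ (linearForm β ^ d) :=
        funext fun i => eval_liftPoly d φ i β
      rw [this]
      exact hr β
    obtain ⟨c, p, hp⟩ := h F (Fin n) m k r (by omega) (liftPoly d φ) hL
    have hmem : φ f ∈ liftRange p d := by
      have hspan := mem_span_linearPowers_of_isHomogeneous hf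
      have hle : Submodule.span F (linearPowers F n d) ≤ (liftRange p d).comap φ := by
        rw [Submodule.span_le]
        rintro _ ⟨α, rfl⟩
        exact apply_linearForm_pow_mem_liftRange φ c p hp α
      exact hle hspan
    calc tensorRankD (φ f) ≤ Fintype.card (FrameIdx p d) := tensorRankD_le_of_mem_liftRange p d hmem
      _ ≤ r * ((d + 1) ^ k * n ^ ((k - 1) * d / k)) := card_frameIdx_le p d hn
      _ = (d + 1) ^ k * n ^ ((k - 1) * d / k) * r := by ring

/-- **Garg–Makam–Oliveira–Wigderson 2019, Thm. 1.16, proved** (discharge of the named fact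
`GMOW2019_thm116`): Thm. 1.16 from the discharged Cor. 1.23 (`GMOW2019_cor123_holds`).
[cite: GargMakamOliveiraWigderson2019, Thm. 1.16] -/
theorem GMOW2019_thm116_holds : GMOW2019_thm116 :=
  GMOW2019_thm116_of_cor123 GMOW2019_cor123_holds

end Literature.Barriers.ValiantsHypothesis
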